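import Mathlib.NumberTheory.LSeries.Dirichlet
import Mathlib.Analysis.MeanInequalities
import Mathlib.Analysis.Convex.Function
import HarnessLib

/-!
# `log ζ(σ)` is convex on `(1, ∞)` (Hölder's inequality on the Dirichlet series)

Trunk T-ANT (`NumberTheory/LFunctions`), family RH.  The soundness input of certified
quadrature of `∫ log ζ(σ) dσ` (the constants of Turing's method, [Trudgian 2011, (2.21)]:
trapezoid sums are *upper* bounds and midpoint sums *lower* bounds for a convex integrand):

* `Literature.NumberTheory.LFunctions.re_riemannZeta_ofReal_eq_tsum` — `ζ(σ) = Σ_{n ≥ 0} (n+1)^{−σ}` for real `σ > 1`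
  (real part of Mathlib's `zeta_eq_tsum_one_div_nat_add_one_cpow`);
* `Literature.NumberTheory.LFunctions.re_riemannZeta_ofReal_le_rpow_mul_rpow` — **log-convexity of `ζ` on the real axis**:
  `ζ(λa + (1−λ)b) ≤ ζ(a)^λ ζ(b)^{1−λ}` (`a, b > 1`, `0 < λ < 1`), by Hölder's inequality for sums
  (Mathlib `Real.inner_le_Lp_mul_Lq_tsum_of_nonneg` with `p = 1/λ`, `q = 1/(1−λ)`);
* `Literature.NumberTheory.LFunctions.convexOn_log_re_riemannZeta` — `σ ↦ log ζ(σ)` is convex on `Ioi 1`.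

## References

* E. C. Titchmarsh, *The Theory of the Riemann Zeta-Function*, 2nd ed., §1.1; G. H. Hardy,
  J. E. Littlewood, G. Pólya, *Inequalities*, Thm 13 (Hölder).  [folklore]
-/

noncomputable section

open Complex Real Set

namespace Literature.NumberTheory.LFunctions

/-- `Re ζ(σ) = Σ_{n ≥ 0} (n+1)^{−σ}` for real `σ > 1`. [folklore] -/
theorem re_riemannZeta_ofReal_eq_tsum {σ : ℝ} (hσ : 1 < σ) :
    (riemannZeta σ).re = ∑' n : ℕ, ((n : ℝ) + 1) ^ (-σ) := by
  have hσ' : 1 < (σ : ℂ).re := by simpa using hσ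
  have hsum : Summable fun n : ℕ ↦ 1 / ((n : ℂ) + 1) ^ (σ : ℂ) := by
    have := (Complex.summable_one_div_nat_cpow (p := (σ : ℂ))).2 hσ'
    rw [← summable_nat_add_iff 1] at this
    simpa using this
  have hterm : ∀ n : ℕ, (1 / ((n : ℂ) + 1) ^ (σ : ℂ)) = ((((n : ℝ) + 1) ^ (-σ) : ℝ) : ℂ) := by
    intro n
    have : ((n : ℂ) + 1) = (((n : ℝ) + 1 : ℝ) : ℂ) := by push_cast; ring
    rw [this, ← Complex.ofReal_cpow (by positivity), Real.rpow_neg (by positivity), one_div,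
      Complex.ofReal_inv]
  rw [zeta_eq_tsum_one_div_nat_add_one_cpow hσ', Complex.re_tsum hsum]
  exact tsum_congr fun n ↦ by rw [hterm, Complex.ofReal_re]

/-- Summability of the real Dirichlet series `Σ (n+1)^{−σ}`, `σ > 1`. [folklore] -/
theorem summable_nat_add_one_rpow_neg {σ : ℝ} (hσ : 1 < σ) :
    Summable fun n : ℕ ↦ ((n : ℝ) + 1) ^ (-σ) := by
  have h := (Real.summable_nat_rpow (p := -σ)).2 (by linarith)
  rw [← summable_nat_add_iff 1] at h
  exact h.congr fun n ↦ by push_cast; ring_nf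

/-- **Log-convexity of `ζ` on the real axis** (Hölder): for `a, b > 1` and `0 < λ < 1`,
`ζ(λa + (1−λ)b) ≤ ζ(a)^λ · ζ(b)^{1−λ}`. [folklore] -/
theorem re_riemannZeta_ofReal_le_rpow_mul_rpow {a b t : ℝ} (ha : 1 < a) (hb : 1 < b)
    (ht0 : 0 < t) (ht1 : t < 1) :
    (riemannZeta ((t * a + (1 - t) * b : ℝ) : ℂ)).re ≤
      (riemannZeta a).re ^ t * (riemannZeta b).re ^ (1 - t) := by
  have hc : 1 < t * a + (1 - t) * b := by nlinarith
  rw [re_riemannZeta_ofReal_eq_tsum hc, re_riemannZeta_ofReal_eq_tsum ha,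
    re_riemannZeta_ofReal_eq_tsum hb]
  -- Hölder with `p = 1/t`, `q = 1/(1-t)`, `f n = (n+1)^{-ta}`, `g n = (n+1)^{-(1-t)b}`
  have hpq : (t⁻¹).HolderConjugate (1 - t)⁻¹ := Real.HolderConjugate.inv_one_sub_inv ht0 ht1
  set f : ℕ → ℝ := fun n ↦ ((n : ℝ) + 1) ^ (-(t * a)) with hf
  set g : ℕ → ℝ := fun n ↦ ((n : ℝ) + 1) ^ (-((1 - t) * b)) with hg
  have hf0 : ∀ n, 0 ≤ f n := fun n ↦ by positivity
  have hg0 : ∀ n, 0 ≤ g n := fun n ↦ by positivity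
  have hfp : ∀ n, f n ^ (t⁻¹) = ((n : ℝ) + 1) ^ (-a) := fun n ↦ by
    simp only [hf]; rw [← Real.rpow_mul (by positivity)]; congr 1; field_simp
  have hgq : ∀ n, g n ^ ((1 - t)⁻¹) = ((n : ℝ) + 1) ^ (-b) := fun n ↦ by
    have : (1 - t) ≠ 0 := by linarith
    simp only [hg]; rw [← Real.rpow_mul (by positivity)]; congr 1; field_simp
  have hfg : ∀ n, f n * g n = ((n : ℝ) + 1) ^ (-(t * a + (1 - t) * b)) := fun n ↦ by
    simp only [hf, hg]; rw [← Real.rpow_add (by positivity)]; ring_nf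
  have hf_sum : Summable fun n ↦ f n ^ (t⁻¹) := by
    simp_rw [hfp]; exact summable_nat_add_one_rpow_neg ha
  have hg_sum : Summable fun n ↦ g n ^ ((1 - t)⁻¹) := by
    simp_rw [hgq]; exact summable_nat_add_one_rpow_neg hb
  have key := Real.inner_le_Lp_mul_Lq_tsum_of_nonneg hpq hf0 hg0 hf_sum hg_sum
  simp only [hfg, one_div, inv_inv] at key
  simp_rw [hfp, hgq] at key
  exact key

/-- **`σ ↦ log ζ(σ)` is convex on `(1, ∞)`.** [folklore] -/
theorem convexOn_log_re_riemannZeta :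
    ConvexOn ℝ (Ioi (1 : ℝ)) (fun σ : ℝ ↦ Real.log (riemannZeta σ).re) := by
  refine ⟨convex_Ioi 1, fun a ha b hb t u ht hu htu ↦ ?_⟩
  simp only [smul_eq_mul]
  have ha' : (1 : ℝ) < a := ha
  have hb' : (1 : ℝ) < b := hb
  rcases ht.eq_or_lt with rfl | ht0
  · simp only [zero_mul, zero_add] at htu ⊢; subst htu; simp
  rcases hu.eq_or_lt with rfl | hu0
  · simp only [add_zero] at htu; subst htu; simp
  have ht1 : t < 1 := by linarith
  have hu' : u = 1 - t := by linarith
  subst hu'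
  have hle := re_riemannZeta_ofReal_le_rpow_mul_rpow ha' hb' ht0 ht1
  have hza := riemannZeta_re_pos_of_one_lt ha'
  have hzb := riemannZeta_re_pos_of_one_lt hb'
  have hzc := riemannZeta_re_pos_of_one_lt (x := t * a + (1 - t) * b) (by nlinarith)
  calc Real.log (riemannZeta ((t * a + (1 - t) * b : ℝ) : ℂ)).re
      ≤ Real.log ((riemannZeta a).re ^ t * (riemannZeta b).re ^ (1 - t)) :=
        Real.log_le_log hzc hle
    _ = t * Real.log (riemannZeta a).re + (1 - t) * Real.log (riemannZeta b).re := by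
        rw [Real.log_mul (by positivity) (by positivity), Real.log_rpow hza, Real.log_rpow hzb]

end Literature.NumberTheory.LFunctions
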